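import Literature.NumberTheory.Automorphic.Liu2021.Def45AsPrinted
import Literature.AlgebraicGeometry.Motives.AbelianVarietyLieAlgebra
import Literature.AlgebraicGeometry.Motives.AbelianVarietyEndAlgebraSemisimpleProofs
import HarnessLib

/-!
# [Liu 2021] Definition 4.5 (2), first bullet, VERBATIM on the Lie algebra `Lie_E(A_μ)`

[Liu2021] Def. 4.5 (2) (TeX l. 1950) asks of a CM datum `D_μ = (A_μ, i_μ, λ_μ, r_μ)`:
«for every `x ∈ M_μ`, the determinant of the action of `i_μ(x)` on the `E`-vector space `Lie_E(A_μ)`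
equals `η_μ(x)`».  The as-printed typing `Liu2021/Def45AsPrinted` (`Def45.CMDatum`) records this
bullet in the cleared-denominator form on the cotangent space `𝔪_e/𝔪_e² = Lie_E(A_μ)^∨`
(READING I1-R4 there): for every presentation `i_μ(x) = M⁻¹ · (1 ⊗ f)`,
`det(f^* | 𝔪_e/𝔪_e²) = M^{dim A_μ} · η_μ(x)`.  With the Lie-algebra vocabulary of
`Motives/AbelianVarietyLieAlgebra` (`AbelianVariety.Lie`, the action `AbelianVariety.lieAction` of
`End⁰(A) = End_E(A)_ℚ` on it) this file proves that the two readings are EQUIVALENT and displays the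
bullet exactly as printed:

* `Def45.det45_iff_det_lieAction` — for any `A/E` and `i : M_μ → End⁰(A)`: the cleared-denominator
  cotangent condition ⟺ `∀ x, det(i(x) | Lie_E(A)) = η_μ(x)`;
* `Def45.CMDatum.det_lieAction_i_eq_eta` — for a CM datum `D`: `det(i_μ(x) | Lie_E(A_μ)) = η_μ(x)`
  (the printed sentence, presentation-free);
* `Def45.CMDatum.apply_det_lieAction_i_eq_finprod` — read in `ℂ` through `ι ∘ φ`:
  `ι(φ(det(i_μ(x) | Lie_E(A_μ)))) = ∏_{θ ∈ Ψ̃_μ} θ(x)`, the product character of the induced CM type.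

Everything is proved (0 named facts); nothing of `Def45AsPrinted` or `AbelianVarietyLieAlgebra` is
redeclared.  The normal form `i(x) = M⁻¹ · (1 ⊗ f)` is the tree's
`AbelianVariety.endAlgebra.exists_eq_algebraMap_mul_of`.

## References

* [Liu2021] Y. Liu, *Fourier–Jacobi cycles and arithmetic relative trace formula*, arXiv:2102.11518,
  Def. 4.5 (TeX ll. 1936–1964; first bullet l. 1950).
-/

noncomputable section

open NumberField
open Literature.AlgebraicGeometry.Motives (AbelianVariety)
open Literature.NumberTheory.ComplexMultiplication

namespace Literature.NumberTheory.Automorphic.Liu2021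

namespace Def45

variable {E : Type} [Field E] [NumberField E] [IsCMField E]
variable {L : Type} [Field L] [NumberField L] [IsGalois ℚ L] {φ : E →ₐ[ℚ] L} {ι : L →+* ℂ}
variable {μ : IdeleClassGroup E →ₜ* Circle} {hμ : IdeleClassGroup.IsConjugateSymplectic E μ}

/-- **The first bullet of [Liu2021] Def. 4.5 (2): printed form ⟺ cleared-denominator cotangent form.**
For an abelian variety `A/E` and a ring homomorphism `i : M_μ → End⁰(A) = End_E(A)_ℚ`:
(`∀ x M f`, `M ≠ 0 → i x = M⁻¹ · (1 ⊗ f) → det(f^* | 𝔪_e/𝔪_e²) = M^{dim A} · η_μ(x)`) — the field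
`CMDatum.det45` — holds iff «for every `x ∈ M_μ`, the determinant of the action of `i(x)` on the
`E`-vector space `Lie_E(A)` equals `η_μ(x)`» (l. 1950, VERBATIM; `AbelianVariety.lieAction`).  Every
`i x` has a presentation (`endAlgebra.exists_eq_algebraMap_mul_of`) and
`det(M⁻¹ · (1 ⊗ f) | Lie) = M^{-dim} det(f^*)` (`AbelianVariety.det_lieAction_eq_iff`).
[cite: Liu2021, Def. 4.5 (2) first bullet (l. 1950)] -/
theorem det45_iff_det_lieAction (A : AbelianVariety E)
    (i : IdeleClassGroup.muAlgValueField E μ →+* A.endAlgebra) :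
    (∀ (x : IdeleClassGroup.muAlgValueField E μ) (M : ℕ) (f : CategoryTheory.End A), M ≠ 0 →
        i x = algebraMap ℚ A.endAlgebra (M : ℚ)⁻¹ * AbelianVariety.endAlgebra.of A f →
          LinearMap.det (AbelianVariety.cotangentMap A f) = (M : E) ^ A.dim * eta φ ι hμ x) ↔
      ∀ x : IdeleClassGroup.muAlgValueField E μ,
        LinearMap.det (AbelianVariety.lieAction A (i x)) = eta φ ι hμ x := by
  constructor
  · intro h x
    obtain ⟨M, f, hM, hx⟩ := AbelianVariety.endAlgebra.exists_eq_algebraMap_mul_of (i x)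
    exact (AbelianVariety.det_lieAction_eq_iff hM hx _).mpr (h x M f hM hx)
  · intro h x M f hM hx
    exact (AbelianVariety.det_lieAction_eq_iff hM hx _).mp (h x)

namespace CMDatum

variable {hw : IdeleClassGroup.HasWeight E μ 1} {C : Carriers E μ} (D : CMDatum φ ι hμ hw C)

/-- **[Liu2021] Def. 4.5 (2), first bullet, AS PRINTED** for a CM datum `D = (A_μ, i_μ, …)`: «for every
`x ∈ M_μ`, the determinant of the action of `i_μ(x)` on the `E`-vector space `Lie_E(A_μ)` equals
`η_μ(x)`» (l. 1950) — `det(i_μ(x) | Lie_E(A_μ)) = η_μ(x)` in `E`, with `Lie_E(A_μ) = AbelianVariety.Lie D.A`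
and the action `AbelianVariety.lieAction D.A : End⁰(A_μ) →ₐ[ℚ] End_E(Lie_E(A_μ))`; presentation-free
corollary of the field `D.det45`. [cite: Liu2021, Def. 4.5 (2) first bullet (l. 1950)] -/
theorem det_lieAction_i_eq_eta (x : IdeleClassGroup.muAlgValueField E μ) :
    LinearMap.det (AbelianVariety.lieAction D.A (D.i x)) = eta φ ι hμ x :=
  (det45_iff_det_lieAction D.A D.i).mp D.det45 x

variable [IsCMField L] in
/-- The first bullet, as printed, read in `ℂ` through `ι ∘ φ`:
`ι(φ(det(i_μ(x) | Lie_E(A_μ)))) = ∏_{θ ∈ Ψ̃_μ} θ(x)`, the product character of the induced CM type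
`Ψ̃_μ = inducedCMType e_μ (reflexCMType ι Φ_μ φ)` (`apply_eta_eq_finprod`) — presentation-free form of
`CMDatum.apply_det_cotangentMap_eq`. [cite: Liu2021, Def. 4.5 (2) first bullet (l. 1950)] -/
theorem apply_det_lieAction_i_eq_finprod (x : IdeleClassGroup.muAlgValueField E μ) :
    ι (φ (LinearMap.det (AbelianVariety.lieAction D.A (D.i x)))) =
      ∏ᶠ θ ∈ (inducedCMType (incl φ ι hμ) (reflexCMType ι hμ.cmType φ)).1, θ x := by
  rw [D.det_lieAction_i_eq_eta x, apply_eta_eq_finprod]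

variable [IsCMField L] in
/-- The same with the quantified embedding `e : M'_μ → M_μ` over `ι` of the cells' binder `hCMisogE`
(`e = incl`, `eq_incl`): `ι(φ(det(i_μ(x) | Lie_E(A_μ)))) = ∏_{θ ∈ inducedCMType e (reflexCMType ι Φ_μ φ)} θ(x)`.
[cite: Liu2021, Def. 4.5 (2) first bullet (l. 1950)] -/
theorem apply_det_lieAction_i_eq_finprod_of_coe_eq
    (e : reflexField ℚ L (algValuedIn ι hμ.cmType.1) →+* IdeleClassGroup.muAlgValueField E μ)
    (he : ∀ k, ((e k : IdeleClassGroup.muAlgValueField E μ) : ℂ) = ι k)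
    (x : IdeleClassGroup.muAlgValueField E μ) :
    ι (φ (LinearMap.det (AbelianVariety.lieAction D.A (D.i x)))) =
      ∏ᶠ θ ∈ (inducedCMType e (reflexCMType ι hμ.cmType φ)).1, θ x := by
  rw [D.det_lieAction_i_eq_eta x, apply_eta_eq_finprod_of_coe_eq φ ι hμ e he]

end CMDatum

end Def45

end Literature.NumberTheory.Automorphic.Liu2021

end
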